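import Summits.NavierStokesRegularity.FluidComputer.SaturationRelay
import Literature.Analysis.FluidPDE.LerayHopfBoundedWindowRegular
import HarnessLib

/-!
# Fluid computer — L11: the saturation relay CONVERGES ON THE BLOW-UP TIME (high levels are quiet away from `T`)

HONEST FRAMING (cell `pub-fluidc`, verbatim): *low prior, high value-of-information experiment on Tao's
machine paradigm; NOT a claim that NS blows up.* Theorem side of the cell; nothing here is evidence of blow-up.

`TerminalWindowFloor` L6–L8 and `SaturationRelay` L10/L10′ say where the level-Reynolds floor of a blow-up is met:
at infinitely many levels inside every terminal window, as an endless relay of saturation events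
(`IsSaturatedLevel b ν (u t) q`: `‖Δ̇_q u(t)‖_∞ ≥ b ν 2^q`) strictly increasing in level AND time. L8 (b) had to take the
`H¹`-control of the early slab `[0, t₀]` as an explicit hypothesis (weak gradients `G t`, `∫|G t|² ≤ D`). Since
`LerayHopfBoundedWindowRegular` (a classical solution on `ℝ³ × [0,T)` which is Leray–Hopf from `u 0` is `H¹`-regular on
`(0,T)` — `IsClassicalNSSolutionOn.isH1RegularOn_Ioo_of_isLerayHopfOn`) that control is a THEOREM on every compact
sub-interval of the open lifespan, and this file records the converse bookkeeping of L8 (b), hypothesis-free: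

* `eventually_not_isSaturatedLevel_of_isH1RegularOn` (**L11, general**) — an `H¹`-regular trajectory on a time set
  `I`, with `L²` slices, has on every compact `K ⊆ I` a level above which NO level is saturated at ANY `t ∈ K`
  (the `H¹` norm is bounded on `K`; Bernstein step of Cheskidov–Shvydkoy 2014, Lemma 4.1 =
  `TerminalWindowFloor.not_isSaturatedLevel_of_lt`);
* `eventually_quiet_Icc` (**L11**) — for a classical solution on `[0,T)`, Leray–Hopf from `u 0`, every `b > 0` and
  every `[t₁, t₀] ⊂ (0, T)`: eventually in `j`, level `j` is quiet throughout `[t₁, t₀]`;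
* `dissipationWavenumber_lt_on_Icc` (**L11 (Λ)**) — hence the Cheskidov–Shvydkoy front `Λ_b(u t)` stays below ONE
  fixed dyadic level on `[t₁, t₀]` — against L7/L7′ (`⨆_{t ∈ (t₀,T)} Λ_b(u t) = ∞` in every terminal window): the
  front diverges AT `T` and nowhere earlier;
* `tendsto_time_of_saturated` (**L11′**) — any sequence of saturation events `(q n, t n)` with `t n ∈ [t₁, T)` and
  levels `q n → ∞` has times `t n → T`;
* `exists_saturation_chain_tendsto` (**L11″**) — the relay of L10′ (levels and times strictly increasing, every event
  saturated) moreover has `t n → T` and `q n → ∞`: a realised blow-up hands the step on upward and forward WITHOUT END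
  AND the hand-offs pile up at the singular time only. In cascade words: a designed relay whose successive events sit
  at ever finer levels but inside a time interval bounded away from the would-be singular time is not a blow-up
  segment; necessity only, no sufficiency claimed.

* `exists_quiet_then_saturated'` (**L8 (b) hypothesis-free**, appended) — quiet throughout `[t₁, t₀]` and saturated after
  `t₀`, at a level `≥ J`: `TerminalWindowFloor.exists_quiet_then_saturated` with its `H¹`-control hypothesis discharged;
* `dissipationWavenumber_lt_top_and_iSup_eq_top` (**L11‴**, appended) — `Λ_b(u t) < ∞` at every `t ∈ (0,T)` beside
  `⨆_{(t₀,T)} Λ_b = ∞` for every `t₀ < T`.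

0 sorry; no new definitions or named facts (inputs: `not_isSaturatedLevel_of_lt`, `exists_strictMono_saturation_chain`,
`isH1RegularOn_Ioo_of_isLerayHopfOn`, the tree's `H¹`-regularity API of `CheskidovShvydkoyRegular`).

## References

* A. Cheskidov, R. Shvydkoy, J. Math. Fluid Mech. 16 (2014) 263–273, Lemma 4.1. [CheskidovShvydkoy2011]
* A. Cheskidov, R. Shvydkoy, Arch. Ration. Mech. Anal. 195 (2010) 159–169, Lemma 3.2. [CheskidovShvydkoy2010]
* J. C. Robinson, J. L. Rodrigo, W. Sadowski, *The Three-Dimensional Navier–Stokes Equations*, CUP 2016, Def. 8.2,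
  Thm. 8.17. [RobinsonRodrigoSadowski2016]
-/

noncomputable section

open MeasureTheory Set Function Filter Topology
open scoped ENNReal NNReal
open Literature.Analysis.FluidPDE Literature.Analysis.FunctionSpaces
open Summit.NavierStokesRegularity.FluidComputer.TerminalWindowFloor

namespace Summit.NavierStokesRegularity.FluidComputer.SaturationHorizon

/-- **L11 (general form) — quiet high levels on compact sets of `H¹`-regular times.** If `u` is `H¹`-regular on a
time set `I` (`IsH1RegularOn I u`: `t ↦ ‖u(t)‖²_{H¹}` finite and continuous on `I`), `K ⊆ I` is compact and the slices
`u t`, `t ∈ K`, are in `L²`, then for every threshold `b > 0` and `ν > 0`: for all sufficiently large levels `j`, NO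
`t ∈ K` has level `j` saturated (`¬ ‖Δ̇_j u(t)‖_∞ ≥ b ν 2^j`). Proof: `‖u(t)‖²_{H¹} ≤ M < ∞` on `K` (maximum of a
continuous function on a compact set), a weak gradient `G` with `∫|G|² < M + 1` witnesses it, and the Bernstein
step `(bν)² 2^j ≤ C ∫|∇u(t)|²` at a saturated level fails once `C (M+1) < (bν)² 2^j`.
[cite: CheskidovShvydkoy2011, Lemma 4.1] -/
theorem eventually_not_isSaturatedLevel_of_isH1RegularOn {I K : Set ℝ}
    {u : ℝ → EuclideanSpace ℝ (Fin 3) → EuclideanSpace ℝ (Fin 3)}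
    (hH1 : IsH1RegularOn I u) (hK : IsCompact K) (hKI : K ⊆ I)
    (hL2 : ∀ t ∈ K, MemLp (u t) 2 volume) {b ν : ℝ} (hb : 0 < b) (hν : 0 < ν) :
    ∀ᶠ j : ℕ in atTop, ∀ t ∈ K, ¬ IsSaturatedLevel b ν (u t) j := by
  obtain ⟨C, hC⟩ := not_isSaturatedLevel_of_lt
  obtain ⟨M, hM, hMK⟩ := hH1.exists_forall_le hK hKI
  -- a level `n` with `C (M + 1) < n (bν)² ≤ 2^j (bν)²` for `j ≥ n`
  have ha : ENNReal.ofReal (b * ν) ^ 2 ≠ 0 := pow_ne_zero _ (ENNReal.ofReal_pos.2 (mul_pos hb hν)).ne'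
  have hM1 : M + 1 < ∞ := ENNReal.add_lt_top.2 ⟨hM, ENNReal.one_lt_top⟩
  have hCM : (C : ℝ≥0∞) * (M + 1) ≠ ∞ := ENNReal.mul_ne_top ENNReal.coe_ne_top hM1.ne
  obtain ⟨n, hn⟩ := ENNReal.exists_nat_mul_gt ha hCM
  refine Filter.eventually_atTop.2 ⟨n, fun j hj t ht => ?_⟩
  have hlt : eH1NormSq (u t) < M + 1 := (hMK t ht).trans_lt (ENNReal.lt_add_right hM.ne one_ne_zero)
  obtain ⟨G, hG, hGlt⟩ := exists_hasWeakGradient_of_eH1NormSq_lt hlt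
  have hD : (∫⁻ x, ENNReal.ofReal (frobeniusNormSq (G x))) < M + 1 := lt_of_le_of_lt le_add_self hGlt
  refine hC b ν j (u t) G (hL2 t ht) hG (hD.trans hM1) ?_
  have hnj : (n : ℝ≥0∞) ≤ (2 : ℝ≥0∞) ^ j :=
    calc (n : ℝ≥0∞) ≤ (j : ℝ≥0∞) := by exact_mod_cast hj
      _ ≤ (2 : ℝ≥0∞) ^ j := by exact_mod_cast (Nat.lt_two_pow_self (n := j)).le
  calc (C : ℝ≥0∞) * (∫⁻ x, ENNReal.ofReal (frobeniusNormSq (G x)))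
      ≤ (C : ℝ≥0∞) * (M + 1) := by gcongr
    _ < n * ENNReal.ofReal (b * ν) ^ 2 := hn
    _ ≤ (2 : ℝ≥0∞) ^ j * ENNReal.ofReal (b * ν) ^ 2 := by gcongr
    _ = ENNReal.ofReal (b * ν) ^ 2 * 2 ^ j := mul_comm _ _

variable {ν T : ℝ} {u : ℝ → EuclideanSpace ℝ (Fin 3) → EuclideanSpace ℝ (Fin 3)} {p : ℝ → EuclideanSpace ℝ (Fin 3) → ℝ}

/-- **L11 — HIGH LEVELS ARE QUIET AWAY FROM THE BLOW-UP TIME (no hypothesis beyond the solution class).** Let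
`(u, p)` be a classical solution of the unforced Navier–Stokes system on `ℝ³ × [0, T)` (`ν > 0`, `T > 0`) which is
Leray–Hopf from `u 0`. Then for every threshold `b > 0` and every compact time interval `[t₁, t₀]` with
`0 < t₁`, `t₀ < T`: for all sufficiently large levels `j`, `‖Δ̇_j u(t)‖_∞ < b ν 2^j` for EVERY `t ∈ [t₁, t₀]`. The
`H¹`-control that L8 (b) (`TerminalWindowFloor.exists_quiet_then_saturated`) took as a hypothesis is supplied by
`IsClassicalNSSolutionOn.isH1RegularOn_Ioo_of_isLerayHopfOn` (`H¹`-regularity on the open lifespan) and the `L²`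
slices by the Leray–Hopf class. (`t₁ > 0`: at `t = 0` only finite energy is assumed.)
[cite: CheskidovShvydkoy2011, Lemma 4.1] -/
theorem eventually_quiet_Icc (hν : 0 < ν) (hT : 0 < T)
    (hcl : IsClassicalNSSolutionOn (Ico 0 T) ν 0 u p) (hLH : IsLerayHopfOn T ν 0 (u 0) u)
    {b : ℝ} (hb : 0 < b) {t₁ t₀ : ℝ} (ht₁ : 0 < t₁) (ht₀ : t₀ < T) :
    ∀ᶠ j : ℕ in atTop, ∀ t ∈ Icc t₁ t₀, ¬ IsSaturatedLevel b ν (u t) j :=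
  eventually_not_isSaturatedLevel_of_isH1RegularOn (hcl.isH1RegularOn_Ioo_of_isLerayHopfOn hν hT hLH)
    isCompact_Icc (Icc_subset_Ioo ht₁ ht₀) (fun t ht => hLH.memLp t ⟨ht₁.le.trans ht.1, ht.2.trans ht₀.le⟩) hb hν

/-- **L11 (Λ) — the front stays below one fixed level on every compact sub-interval of the open lifespan.** In the
setting of `eventually_quiet_Icc` there is a level `J` with `Λ_b(u t) < 2^J` for every `t ∈ [t₁, t₀]`
(`Λ` = the tree's `dissipationWavenumber`, `1 ⊔ sup_{saturated j} 2^j`; if `2^J ≤ Λ_b(u t)` with `J = n + 1` then some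
level `> n` is saturated, `exists_isSaturatedLevel_of_two_pow_succ_le`). Read against L7′
(`TerminalWindowFloor.iSup_dissipationWavenumber_window_eq_top'`: `⨆_{t ∈ (t₀,T)} Λ = ∞` in EVERY terminal window of a
maximal solution) this localises the divergence of the front AT the blow-up time.
[cite: CheskidovShvydkoy2011, Lemma 4.1] -/
theorem dissipationWavenumber_lt_on_Icc (hν : 0 < ν) (hT : 0 < T)
    (hcl : IsClassicalNSSolutionOn (Ico 0 T) ν 0 u p) (hLH : IsLerayHopfOn T ν 0 (u 0) u)
    {b : ℝ} (hb : 0 < b) {t₁ t₀ : ℝ} (ht₁ : 0 < t₁) (ht₀ : t₀ < T) :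
    ∃ J : ℕ, ∀ t ∈ Icc t₁ t₀, dissipationWavenumber b ν (u t) < (2 : ℝ≥0∞) ^ J := by
  obtain ⟨n, hn⟩ := Filter.eventually_atTop.1 (eventually_quiet_Icc hν hT hcl hLH hb ht₁ ht₀)
  refine ⟨n + 1, fun t ht => not_le.1 fun hfront => ?_⟩
  obtain ⟨j, hnj, hsat⟩ := exists_isSaturatedLevel_of_two_pow_succ_le hfront
  exact hn j hnj.le t ht hsat

/-- **L11′ — SATURATION EVENTS ACCUMULATE ONLY AT THE BLOW-UP TIME.** In the setting of `eventually_quiet_Icc`, let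
`(q n, t n)` be any sequence of saturation events — `‖Δ̇_{q n} u(t n)‖_∞ ≥ b ν 2^{q n}`, `b > 0` — with times in
`[t₁, T)` for some `t₁ > 0` and levels `q n → ∞`. Then `t n → T`: for every `t₀ < T` the levels eventually exceed
the quiet threshold of `[t₁, t₀]`, so `t n > t₀` eventually; and `t n < T` throughout.
[cite: CheskidovShvydkoy2011, Lemma 4.1] -/
theorem tendsto_time_of_saturated (hν : 0 < ν) (hT : 0 < T)
    (hcl : IsClassicalNSSolutionOn (Ico 0 T) ν 0 u p) (hLH : IsLerayHopfOn T ν 0 (u 0) u)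
    {b : ℝ} (hb : 0 < b) {q : ℕ → ℕ} {t : ℕ → ℝ} (hq : Tendsto q atTop atTop)
    {t₁ : ℝ} (ht₁ : 0 < t₁) (ht : ∀ n, t₁ ≤ t n ∧ t n < T)
    (hsat : ∀ n, IsSaturatedLevel b ν (u (t n)) (q n)) :
    Tendsto t atTop (𝓝 T) := by
  have hev : ∀ t₀ < T, ∀ᶠ n in atTop, t₀ < t n := by
    intro t₀ ht₀
    filter_upwards [hq.eventually (eventually_quiet_Icc hν hT hcl hLH hb ht₁ ht₀)] with n hn
    by_contra hle
    exact hn (t n) ⟨(ht n).1, not_lt.1 hle⟩ (hsat n)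
  exact tendsto_order.2 ⟨fun t₀ ht₀ => hev t₀ ht₀, fun t₀ ht₀ => Eventually.of_forall fun n => (ht n).2.trans ht₀⟩

/-- **L11″ — THE RELAY CONVERGES ON THE BLOW-UP TIME.** With the absolute `c > 0` of Cheskidov–Shvydkoy 2010,
Lemma 3.2 (`SaturationRelay.exists_strictMono_saturation_chain`): along every maximal smooth solution `(u, p)` of the
unforced Navier–Stokes system on `ℝ³ × [0, T)` (`ν > 0`) which is Leray–Hopf from `u 0`, and for every threshold
`b ∈ (0, c)`, there is a chain of saturation events `(q n, t n)` — levels `q` and times `t` BOTH strictly increasing,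
`0 < t n < T`, level `q n` saturated at time `t n` — with `t n → T` and `q n → ∞`. The first four clauses are L10′; the
convergence is L11′ applied to the chain (its times lie in `[t 0, T)`, `t 0 > 0`; a strictly increasing sequence of
levels tends to `∞`). Necessity only: a blow-up organised as an upward relay must compress its hand-offs onto the
singular time; a relay whose ever-finer events stay inside a time interval bounded away from `T` is excluded.
[cite: CheskidovShvydkoy2010, Lemma 3.2] -/
theorem exists_saturation_chain_tendsto :
    ∃ c : ℝ, 0 < c ∧ ∀ (ν T : ℝ), 0 < ν → 0 < T →
      ∀ (u : ℝ → EuclideanSpace ℝ (Fin 3) → EuclideanSpace ℝ (Fin 3)) (p : ℝ → EuclideanSpace ℝ (Fin 3) → ℝ),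
      IsMaximalSmoothSolution ν 0 u p T → IsLerayHopfOn T ν 0 (u 0) u →
      ∀ b : ℝ, 0 < b → b < c →
        ∃ (q : ℕ → ℕ) (t : ℕ → ℝ), StrictMono q ∧ StrictMono t ∧ (∀ n, 0 < t n ∧ t n < T) ∧
          (∀ n, IsSaturatedLevel b ν (u (t n)) (q n)) ∧ Tendsto t atTop (𝓝 T) ∧ Tendsto q atTop atTop := by
  obtain ⟨c, hc, H⟩ := SaturationRelay.exists_strictMono_saturation_chain
  refine ⟨c, hc, fun ν T hν hT u p hmax hLH b hb hbc => ?_⟩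
  obtain ⟨q, t, hq, ht, htT, hsat⟩ := H ν T hν hT u p hmax hLH b hbc
  have hqtop : Tendsto q atTop atTop := hq.tendsto_atTop
  exact ⟨q, t, hq, ht, htT, hsat,
    tendsto_time_of_saturated hν hT hmax.1 hLH hb hqtop (htT 0).1
      (fun n => ⟨ht.monotone (Nat.zero_le n), (htT n).2⟩) hsat, hqtop⟩

/-- **L8 (b) hypothesis-free — LADDER ORDER: quiet throughout `[t₁, t₀]`, saturated after `t₀`.** With the absolute
`c > 0` of Cheskidov–Shvydkoy 2010, Lemma 3.2 (`TerminalWindowFloor.exists_saturated_after'`): for every maximal smooth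
solution `(u, p)` of the unforced Navier–Stokes system on `ℝ³ × [0, T)` (`ν > 0`), Leray–Hopf from `u 0`, every
`0 < t₁`, `t₀ < T` (`0 ≤ t₀`), every `b ∈ (0, c)` and every `J`, there is a level `j ≥ J` which is QUIET at every
`t ∈ [t₁, t₀]` and SATURATED at some `t ∈ (t₀, T)`. This is `TerminalWindowFloor.exists_quiet_then_saturated` (L8 (b))
with its by-hand `H¹`-control hypothesis (weak gradients `G t`, `∫|G t|² ≤ D` on `[0, t₀]`) DISCHARGED on `[t₁, t₀]`
by `eventually_quiet_Icc` (the slab starts at `t₁ > 0` because only finite energy is assumed at `t = 0`): the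
saturation front migrates to ever finer levels as `t ↑ T`, and a later window needs finer levels — hypothesis-free.
[cite: CheskidovShvydkoy2010, Lemma 3.2] [cite: CheskidovShvydkoy2011, Lemma 4.1] -/
theorem exists_quiet_then_saturated' :
    ∃ c : ℝ, 0 < c ∧ ∀ (ν T : ℝ), 0 < ν → 0 < T →
      ∀ (u : ℝ → EuclideanSpace ℝ (Fin 3) → EuclideanSpace ℝ (Fin 3)) (p : ℝ → EuclideanSpace ℝ (Fin 3) → ℝ),
      IsMaximalSmoothSolution ν 0 u p T → IsLerayHopfOn T ν 0 (u 0) u →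
      ∀ t₁ t₀ : ℝ, 0 < t₁ → t₀ ∈ Ico 0 T → ∀ b : ℝ, 0 < b → b < c → ∀ J : ℕ,
        ∃ j : ℕ, J ≤ j ∧ (∀ t ∈ Icc t₁ t₀, ¬ IsSaturatedLevel b ν (u t) j) ∧
          ∃ t ∈ Ioo t₀ T, IsSaturatedLevel b ν (u t) j := by
  obtain ⟨c, hc, H⟩ := exists_saturated_after'
  refine ⟨c, hc, fun ν T hν hT u p hmax hLH t₁ t₀ ht₁ ht₀ b hb hbc J => ?_⟩
  -- a quiet threshold `n` for `[t₁, t₀]`, then L6′ above `max J n`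
  obtain ⟨n, hn⟩ := Filter.eventually_atTop.1 (eventually_quiet_Icc hν hT hmax.1 hLH hb ht₁ ht₀.2)
  obtain ⟨j, hJj, t, htI, hsat⟩ := H ν T hν hT u p hmax hLH t₀ ht₀ b hbc (max J n)
  exact ⟨j, (le_max_left J n).trans hJj, hn j ((le_max_right J n).trans hJj), t, htI, hsat⟩

/-- **L11‴ — the front is FINITE at every time of the open lifespan and INFINITE in the limit `t ↑ T`** (the two halves
side by side, for the atlas's gloss): for a maximal smooth solution as above and `b ∈ (0, c)`, every `t ∈ (0, T)` has
`Λ_b(u t) < ∞` (indeed `< 2^J` uniformly on compact sub-intervals, `dissipationWavenumber_lt_on_Icc`), while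
`⨆_{t ∈ (t₀, T)} Λ_b(u t) = ∞` for every `t₀ < T` (`TerminalWindowFloor.iSup_dissipationWavenumber_window_eq_top'`).
[cite: CheskidovShvydkoy2011, Lemma 4.1] -/
theorem dissipationWavenumber_lt_top_and_iSup_eq_top :
    ∃ c : ℝ, 0 < c ∧ ∀ (ν T : ℝ), 0 < ν → 0 < T →
      ∀ (u : ℝ → EuclideanSpace ℝ (Fin 3) → EuclideanSpace ℝ (Fin 3)) (p : ℝ → EuclideanSpace ℝ (Fin 3) → ℝ),
      IsMaximalSmoothSolution ν 0 u p T → IsLerayHopfOn T ν 0 (u 0) u →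
      ∀ b : ℝ, 0 < b → b < c →
        (∀ t ∈ Ioo 0 T, dissipationWavenumber b ν (u t) < ∞) ∧
          ∀ t₀ ∈ Ico 0 T, (⨆ t ∈ Ioo t₀ T, dissipationWavenumber b ν (u t)) = ∞ := by
  obtain ⟨c, hc, H⟩ := iSup_dissipationWavenumber_window_eq_top'
  refine ⟨c, hc, fun ν T hν hT u p hmax hLH b hb hbc => ⟨fun t ht => ?_, fun t₀ ht₀ => H ν T hν hT u p hmax hLH t₀ ht₀ b hbc⟩⟩
  obtain ⟨J, hJ⟩ := dissipationWavenumber_lt_on_Icc hν hT hmax.1 hLH hb ht.1 ht.2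
  exact (hJ t ⟨le_rfl, le_rfl⟩).trans_le le_top

end Summit.NavierStokesRegularity.FluidComputer.SaturationHorizon

end
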